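import Summits.ValiantsHypothesis.ValiantsHypothesis.Theorems.DepthWindowTopBracketCircuit
import Summits.ValiantsHypothesis.ValiantsHypothesis.Theorems.DepthWindowBinarisation
import Summits.ValiantsHypothesis.ValiantsHypothesis.Statement
import Literature.Computability.AlgebraicComplexity.ValiantConjectureEquivProofs
import Literature.Computability.AlgebraicComplexity.StandardFamiliesProofs
import HarnessLib

/-!
# Route `DepthWindow` — the TOP BRACKET of the product-depth dial sits at EVERY positive fraction of `log₂ n`

Decomp-valiant workshop, lens 4 «depth-reduction / chasm axis», generation 48 (cell O32 «top-bracket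
squeeze»), part 5/5 (parts 1–4: `DepthWindowTopBracket{Defs,Expansion,Levels,Circuit}.lean`).
Route-independent and definition-free (imports no `Theses` file; the items are restated in the dial's
literal shape).  The dial of `Theorems/DepthWindowDial.lean`: `A_Δ` = "no `c` such that every per_n has an
unbounded fan-in circuit over ℂ of product-depth `≤ Δ(n)` with `≤ n^c + c` wires", `B_Δ` = "`VP_ℂ = VNP_ℂ` ⟹
such a `c` exists"; `VH ↔ A_Δ ∧ B_Δ` at every `Δ`; the route's node is `Δ₁(n) = L₃(n) + 1` (items
`PerHardLog3` = `A_Δ₁`, `CollapseLog3` = `B_Δ₁`, declared residual).  `DepthWindowDial` §3 records the top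
bracket at the VSBR depth: `B_{⌈log₂ n⌉+1}` is a theorem, so `A_{⌈log₂ n⌉+1} ↔ VH`.  This file moves the
bracket to every fixed fraction of `⌈log₂ n⌉`:

* `collapseToDepth_clog_div (hK : 1 ≤ K) : B_{⌈⌈log₂ n⌉/K⌉}` UNCONDITIONALLY (the rung), and the rounded
  form `collapseToDepth_clog_div_succ_holds : B_{⌈log₂ n⌉/K + 1}`;
* `perHardAtDepth_clog_div_succ_iff_vh (hK : 1 ≤ K) : A_{⌈log₂ n⌉/K + 1} ↔ VH` (and the ceiling form
  `perHardAtDepth_clog_cdiv_iff_vh : A_{⌈⌈log₂ n⌉/K⌉} ↔ VH`); at `K = 1` this is the Dial's bracket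
  `DepthWindowDial.perHardAtDepth_clog_succ_iff_vh` (`Nat.div_one`), not restated here.

So the region of the dial where the attackable piece IS the summit begins at `Δ(n) = ε·log₂ n` for every
`ε > 0`, not only at slope one: the honest open window of the node is `L₃(n) < Δ(n) = o(log n)` (record
correction of the workshop census sentence "threshold type `n^(ω(Δ·n^(1/Δ)))` bottoming out at VSBR": the `Δ`
in that exponent is the FORMULA bound of Limaye–Srinivasan–Tavenas §1; for circuits, with sharing, the
`K`-fold VSBR construction of part 4 is polynomial at `Δ = log₂ n / K`).

HONESTY.  Nothing in this file bears on `VP ≠ VNP`; it proves no crux of the route, does NOT move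
`PerHardLog3` / `CollapseLog3`, earns no S-currency; it certifies where the dial's EQUIV region starts.
The underlying depth reduction is the folklore regrouping of VSBR 1983 / Agrawal–Vinay 2008 / Tavenas 2015
(`K` halvings per product level, atoms shared); no novelty beyond kernel bookkeeping is claimed.
0 sorry, standard axioms.

LABEL (critic RULING O32, bus 3158, verbatim).  «O32 (lens-4 g48): VARIANT · FOLKLORE (K-fold ×-balanced
VSBR / Agrawal–Vinay / Tavenas expansion inside one level with atoms SHARED across levels = the d^{1/Δ} =
2^K end of the known depth-reduction trade-off) · kernel-new bookkeeping · WINDOW CERTIFICATE on the C1 dial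
D_Δ[poly]: B_{⌈⌈log₂ n⌉/K⌉} is a THEOREM and A_{⌈log₂ n⌉/K+1} ↔ VH for every fixed K ≥ 1 — the EQUIV
(COSTUME) region of the dial begins at every positive fraction ε·log₂ n, not only at the VSBR slope ⌈log₂
n⌉+1; the honest open window L₃(n) < Δ(n) = o(log n) stays UNDECIDED · IDEA-NEEDED (the construction has
n^{O(5^K)} wires — nothing at K(n) → ∞) · 0 S-currency · closes / re-tags NO item · both routes and
stmt-11333 untouched · VP ≠ VNP untouched»

«HONEST BOUNDARY (O32): for every FIXED K ≥ 1, if VP = VNP then the permanent family has unbounded-fan-in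
circuits of product-depth at most ⌈log₂ n⌉/K + 1 with polynomially many wires (the exponent grows like 5^K),
so hardness of per_n at product-depth ⌈log₂ n⌉/K + 1 is EQUIVALENT to Valiant's hypothesis; nothing is
claimed at product-depth o(log n) (letting K = K(n) → ∞ makes the wire bound superpolynomial), no item is
closed or re-tagged, no S-currency is earned, VP ≠ VNP is untouched.»

Tokens (K5): 0 S-currency · closes NO item · UNDECIDED · IDEA-NEEDED.

References: [ValiantSkyumBerkowitzRackoff1983]; [Burgisser2000TCS] Thm. 2.5, §2; [Tavenas2015] §5 Prop. 3;
[AgrawalVinay2008]; [LimayeSrinivasanTavenas2025] §1 (product depth).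
-/

-- layout Summits/ValiantsHypothesis/ValiantsHypothesis forces the duplicated namespace component
set_option linter.dupNamespace false

noncomputable section

open MvPolynomial Literature.Computability.AlgebraicComplexity
open Literature.Computability.AlgebraicComplexity.DepthReduction ArithCircuit

namespace Summit.ValiantsHypothesis.ValiantsHypothesis.Theorems.DepthWindow

namespace TopBracket

/-- The two-line assembly `A_Δ → B_Δ → VH` (local copy). [folklore] -/
theorem vh_of_perHard_of_collapse {Δ : ℕ → ℕ}
    (hB : VP ℂ = VNP ℂ → ∃ c : ℕ, ∀ n : ℕ, ∃ C : ArithCircuit ℂ (Fin n × Fin n),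
      C.Computes (perPoly (Fin n) ℂ) ∧ C.productDepth ≤ Δ n ∧ C.edgeSize ≤ n ^ c + c)
    (hA : ¬ ∃ c : ℕ, ∀ n : ℕ, ∃ C : ArithCircuit ℂ (Fin n × Fin n),
      C.Computes (perPoly (Fin n) ℂ) ∧ C.productDepth ≤ Δ n ∧ C.edgeSize ≤ n ^ c + c) :
    _root_.ValiantsHypothesis :=
  fun hEq => hA (hB hEq)

/-- Binarisation step in `IsPComputable` form: a polynomial-wire unbounded-fan-in family computing per_n
(at any product depth) makes the permanent family p-computable, by `complexity_eval_le_two_mul_edgeSize`.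
[cite: Burgisser2000TCS, §2] -/
theorem isPComputable_per_of_collapse {Δ : ℕ → ℕ}
    (hc : ∃ c : ℕ, ∀ n : ℕ, ∃ C : ArithCircuit ℂ (Fin n × Fin n),
      C.Computes (perPoly (Fin n) ℂ) ∧ C.productDepth ≤ Δ n ∧ C.edgeSize ≤ n ^ c + c) :
    IsPComputable (fun n => perPoly (Fin n) ℂ) := by
  obtain ⟨c, hc⟩ := hc
  have hb : IsPBounded fun n : ℕ => 2 * (n ^ c + c) :=
    IsPBounded.mul_holds (IsPBounded.const 2) ⟨c, fun _ => le_rfl⟩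
  refine hb.mono fun n => ?_
  obtain ⟨C, hC, -, hCe⟩ := hc n
  rw [ArithCircuit.Computes] at hC
  show complexity (perPoly (Fin n) ℂ) ≤ 2 * (n ^ c + c)
  rw [← hC]
  exact (complexity_eval_le_two_mul_edgeSize C).trans (Nat.mul_le_mul_left 2 hCe)

end TopBracket

open TopBracket

/-- The `K`-fold wire bound at polynomial size is polynomially bounded (fixed `K`). [folklore] -/
theorem isPBounded_iterEdgeBound (K c : ℕ) :
    IsPBounded fun n : ℕ => iterEdgeBound K (n * n) n (n ^ c + c) := by
  have hid : IsPBounded fun n : ℕ => n := IsPBounded.id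
  have hs : IsPBounded fun n : ℕ => n ^ c + c := ⟨c, fun _ => le_rfl⟩
  have h1 : IsPBounded fun n : ℕ => n + 1 := IsPBounded.add_holds hid (IsPBounded.const 1)
  have hN : IsPBounded fun n : ℕ => n * n + 1 :=
    IsPBounded.add_holds (IsPBounded.mul_holds hid hid) (IsPBounded.const 1)
  have hI : IsPBounded fun n : ℕ => 4 * (n ^ c + c) * (n + 1) ^ 2 :=
    IsPBounded.mul_holds (IsPBounded.mul_holds (IsPBounded.const 4) hs) (IsPBounded.pow_holds h1 2)
  have hA : IsPBounded fun n : ℕ =>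
      4 * (n ^ c + c) * (n + 1) ^ 2 + (4 * (n ^ c + c) * (n + 1) ^ 2) * (4 * (n ^ c + c) * (n + 1) ^ 2) :=
    IsPBounded.add_holds hI (IsPBounded.mul_holds hI hI)
  have hW : IsPBounded fun n : ℕ =>
      ((4 * (n ^ c + c) * (n + 1) ^ 2) * (4 * (n ^ c + c) * (n + 1) ^ 2)) ^ iterExp K :=
    IsPBounded.pow_holds (IsPBounded.mul_holds hI hI) _
  have hW1 : IsPBounded fun n : ℕ =>
      ((4 * (n ^ c + c) * (n + 1) ^ 2) * (4 * (n ^ c + c) * (n + 1) ^ 2)) ^ iterExp K + 1 :=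
    IsPBounded.add_holds hW (IsPBounded.const 1)
  have h : IsPBounded fun n : ℕ =>
      (4 * (n ^ c + c) * (n + 1) ^ 2 +
            (4 * (n ^ c + c) * (n + 1) ^ 2) * (4 * (n ^ c + c) * (n + 1) ^ 2)) * (n * n + 1) +
        n * ((4 * (n ^ c + c) * (n + 1) ^ 2 +
                  (4 * (n ^ c + c) * (n + 1) ^ 2) * (4 * (n ^ c + c) * (n + 1) ^ 2)) *
                ((4 * (n ^ c + c) * (n + 1) ^ 2) * (4 * (n ^ c + c) * (n + 1) ^ 2)) ^ iterExp K *
              5 ^ K +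
            (4 * (n ^ c + c) * (n + 1) ^ 2 +
                (4 * (n ^ c + c) * (n + 1) ^ 2) * (4 * (n ^ c + c) * (n + 1) ^ 2)) *
              (((4 * (n ^ c + c) * (n + 1) ^ 2) * (4 * (n ^ c + c) * (n + 1) ^ 2)) ^ iterExp K + 1)) +
        (n + 1) :=
    IsPBounded.add_holds
      (IsPBounded.add_holds (IsPBounded.mul_holds hA hN)
        (IsPBounded.mul_holds hid
          (IsPBounded.add_holds
            (IsPBounded.mul_holds (IsPBounded.mul_holds hA hW) (IsPBounded.const _))
            (IsPBounded.mul_holds hA hW1))))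
      h1
  exact h.mono fun _ => le_of_eq rfl

/-- **The rung `B_{⌈⌈log₂ n⌉/K⌉}`**, unconditional for every `K ≥ 1`: if `VP_ℂ = VNP_ℂ` then for some `c`
every per_n has a circuit of product-depth `≤ ⌈⌈log₂ n⌉/K⌉` with at most `n^c + c` wires.
[cite: ValiantSkyumBerkowitzRackoff1983] [cite: Tavenas2015, Prop. 3] -/
theorem collapseToDepth_clog_div {K : ℕ} (hK : 1 ≤ K) :
    VP ℂ = VNP ℂ → ∃ c : ℕ, ∀ n : ℕ, ∃ C : ArithCircuit ℂ (Fin n × Fin n),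
      C.Computes (perPoly (Fin n) ℂ) ∧ C.productDepth ≤ (Nat.clog 2 n + K - 1) / K ∧
        C.edgeSize ≤ n ^ c + c := by
  intro hEq
  have hP : IsPComputable (fun n => perPoly (Fin n) ℂ) := isPComputable_perPoly_complex_iff.mpr hEq
  obtain ⟨c, hc⟩ := hP
  obtain ⟨c', hc'⟩ := isPBounded_iterEdgeBound K c
  refine ⟨c', fun n => ?_⟩
  have hd : (perPoly (Fin n) ℂ).totalDegree ≤ n := by
    rw [totalDegree_perPoly_holds (n := Fin n) (k := ℂ), Fintype.card_fin]
  obtain ⟨C, hC, hCΔ, hCe⟩ := exists_computes_productDepth_le_clog_div hK (perPoly (Fin n) ℂ) hd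
  refine ⟨C, hC, hCΔ, ?_⟩
  calc C.edgeSize ≤ iterEdgeBound K (Fintype.card (Fin n × Fin n)) n (complexity (perPoly (Fin n) ℂ)) := hCe
    _ ≤ iterEdgeBound K (n * n) n (n ^ c + c) := by
        rw [Fintype.card_prod, Fintype.card_fin]; exact iterEdgeBound_mono_s (hc n)
    _ ≤ n ^ c' + c' := hc' n

/-- The rung in the rounded form `B_{⌊⌈log₂ n⌉/K⌋ + 1}`. [cite: ValiantSkyumBerkowitzRackoff1983] -/
theorem collapseToDepth_clog_div_succ_holds {K : ℕ} (hK : 1 ≤ K) :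
    VP ℂ = VNP ℂ → ∃ c : ℕ, ∀ n : ℕ, ∃ C : ArithCircuit ℂ (Fin n × Fin n),
      C.Computes (perPoly (Fin n) ℂ) ∧ C.productDepth ≤ Nat.clog 2 n / K + 1 ∧ C.edgeSize ≤ n ^ c + c :=
  fun hEq => by
  obtain ⟨c, hc⟩ := collapseToDepth_clog_div hK hEq
  refine ⟨c, fun n => ?_⟩
  obtain ⟨C, h1, h2, h3⟩ := hc n
  exact ⟨C, h1, h2.trans (cdiv_le_div_succ hK (Nat.clog 2 n)), h3⟩

/-- **Top bracket at every fraction of `log₂ n` (kernel iff)**: for every `K ≥ 1`, at depth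
`⌊⌈log₂ n⌉/K⌋ + 1` the attackable piece IS the summit, `A_{⌈log₂ n⌉/K+1} ↔ VH`.
[cite: ValiantSkyumBerkowitzRackoff1983] [cite: Tavenas2015, Prop. 3] -/
theorem perHardAtDepth_clog_div_succ_iff_vh {K : ℕ} (hK : 1 ≤ K) :
    (¬ ∃ c : ℕ, ∀ n : ℕ, ∃ C : ArithCircuit ℂ (Fin n × Fin n),
      C.Computes (perPoly (Fin n) ℂ) ∧ C.productDepth ≤ Nat.clog 2 n / K + 1 ∧ C.edgeSize ≤ n ^ c + c) ↔
    _root_.ValiantsHypothesis :=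
  ⟨fun hA => TopBracket.vh_of_perHard_of_collapse (collapseToDepth_clog_div_succ_holds hK) hA,
    fun h hc => h (isPComputable_perPoly_complex_iff.mp (TopBracket.isPComputable_per_of_collapse hc))⟩

/-- The sharper ceiling form: `A_{⌈⌈log₂ n⌉/K⌉} ↔ VH` for every `K ≥ 1`.
[cite: ValiantSkyumBerkowitzRackoff1983] [cite: Tavenas2015, Prop. 3] -/
theorem perHardAtDepth_clog_cdiv_iff_vh {K : ℕ} (hK : 1 ≤ K) :
    (¬ ∃ c : ℕ, ∀ n : ℕ, ∃ C : ArithCircuit ℂ (Fin n × Fin n),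
      C.Computes (perPoly (Fin n) ℂ) ∧ C.productDepth ≤ (Nat.clog 2 n + K - 1) / K ∧
        C.edgeSize ≤ n ^ c + c) ↔
    _root_.ValiantsHypothesis :=
  ⟨fun hA => TopBracket.vh_of_perHard_of_collapse (collapseToDepth_clog_div hK) hA,
    fun h hc => h (isPComputable_perPoly_complex_iff.mp (TopBracket.isPComputable_per_of_collapse hc))⟩

/-- **HONEST READING.** For every `K ≥ 1` the dial's top bracket sits at `⌈log₂ n⌉/K + 1`: there the
attackable piece `A` IS the summit and the residual `B` is a THEOREM (`collapseToDepth_clog_div_succ_holds`).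
Nothing here proves `VP ≠ VNP`, closes `PerHardLog3` (`A` at `L₃(n)+1`) or `CollapseLog3` (its declared
residual), or says anything at depths `o(log n)`: the `K`-fold circuit has `n^(O(5^K))` wires, superpolynomial
as soon as `K = K(n) → ∞`.  The honest open window of the route's dial is `L₃(n) < Δ(n) = o(log n)`. [folklore] -/
theorem top_bracket_every_fraction {K : ℕ} (hK : 1 ≤ K) :
    ((¬ ∃ c : ℕ, ∀ n : ℕ, ∃ C : ArithCircuit ℂ (Fin n × Fin n),
        C.Computes (perPoly (Fin n) ℂ) ∧ C.productDepth ≤ Nat.clog 2 n / K + 1 ∧ C.edgeSize ≤ n ^ c + c) ↔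
      _root_.ValiantsHypothesis) ∧
    (VP ℂ = VNP ℂ → ∃ c : ℕ, ∀ n : ℕ, ∃ C : ArithCircuit ℂ (Fin n × Fin n),
      C.Computes (perPoly (Fin n) ℂ) ∧ C.productDepth ≤ Nat.clog 2 n / K + 1 ∧ C.edgeSize ≤ n ^ c + c) :=
  ⟨perHardAtDepth_clog_div_succ_iff_vh hK, collapseToDepth_clog_div_succ_holds hK⟩

end Summit.ValiantsHypothesis.ValiantsHypothesis.Theorems.DepthWindow

end
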